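import Mathlib
import Summits.Ventures.PercRepro2.TypedHat

/-!
# An unmarked vertex whose typed edges go to the two roots (blind cell PercRepro2, p2 g0,
2026-08-25; sub-claim S1, the hat class of mine-1's MINE1-J1.md §23.11 — the adjacent-hats step)

Let `w` be unmarked with typed edges exactly `f₁ = w–a₁` and `f₂ = w–a₂` (any types), every other
edge at `w` pinned closed and untyped. A copy carrying both joins the roots (killed by the
root-pair property); a copy carrying one of them has `w` pendant at a root, invisible to every
connection among the other vertices (p1's `StarPattern.conn_update_false_pendant`); so the typed
count is a NONNEGATIVE multiple (the number of live placements) of the typed count with the two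
edges removed:

* **`typedCount_rootVertex_st`** — `∃ c ≥ 0, N = c · N(F ∖ {f₁, f₂})` for every state kernel with
  the root-pair property; **`typedCount_rootVertex`** — the same for `K₃`.

Own code; standard axioms.
-/

namespace Summit.Ventures.PercRepro2

open UnionCluster

namespace CovForm

namespace TypedRed

open OneTyped

section RootVertexState

variable {V : Type*} {E : Type*} [DecidableEq E]
variable (ends : E → Sym2 V) (o a₁ a₂ a₃ b : V)

/-- The state does not see a root-pendant vertex: opening at most one of `f₁`, `f₂` at a
configuration closed at `w` leaves the state unchanged. -/
theorem st_rootVertex {w : V} {f₁ f₂ : E} (h1 : ends f₁ = s(w, a₁)) (h2 : ends f₂ = s(w, a₂))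
    (h12 : f₁ ≠ f₂) (hwo : w ≠ o) (hw1 : w ≠ a₁) (hw2 : w ≠ a₂) (hw3 : w ≠ a₃) (hwb : w ≠ b)
    {x : Config E} (hx1 : x f₁ = false) (hx2 : x f₂ = false)
    (hcl : ∀ e, w ∈ ends e → e ≠ f₁ → e ≠ f₂ → x e = false) {a a' : Bool}
    (hl : ¬ (a = true ∧ a' = true)) :
    st ends o a₁ a₂ a₃ b (Function.update (Function.update x f₂ a') f₁ a) =
      st ends o a₁ a₂ a₃ b x := by
  have key : ∀ {p q : V}, p ≠ w → q ≠ w →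
      (Conn ends (Function.update (Function.update x f₂ a') f₁ a) p q ↔ Conn ends x p q) := by
    intro p q hp hq
    have e2 : Function.update x f₂ false = x := Function.update_eq_self_iff.2 hx2.symm
    have e1 : Function.update x f₁ false = x := Function.update_eq_self_iff.2 hx1.symm
    cases a <;> cases a'
    · rw [e2, e1]
    · -- `f₂` open: `w` pendant at `a₂`
      have e1 : Function.update (Function.update x f₂ true) f₁ false =
          Function.update x f₂ true :=
        Function.update_eq_self_iff.2 (by rw [Function.update_of_ne h12, hx1])
      rw [e1]
      have hpend := StarPattern.conn_update_false_pendant (ω := Function.update x f₂ true) h2 hw2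
        (fun g hg hwg => Or.inr (by
          rw [Function.update_of_ne hg]
          by_cases hg1 : g = f₁
          · subst hg1; exact hx1
          · exact hcl g hwg hg1 hg)) hp hq
      rw [Function.update_idem, e2] at hpend
      exact hpend
    · -- `f₁` open: `w` pendant at `a₁`
      rw [e2]
      have hpend := StarPattern.conn_update_false_pendant (ω := Function.update x f₁ true) h1 hw1
        (fun g hg hwg => Or.inr (by
          rw [Function.update_of_ne hg]
          by_cases hg2 : g = f₂
          · subst hg2; exact hx2
          · exact hcl g hwg hg hg2)) hp hq
      rw [Function.update_idem, e1] at hpend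
      exact hpend
    · exact absurd ⟨rfl, rfl⟩ hl
  unfold st
  simp only [Prod.mk.injEq]
  exact ⟨decide_eq_decide.mpr (key hw2.symm hw1.symm), decide_eq_decide.mpr (key hw1.symm hwo.symm),
    decide_eq_decide.mpr (key hw2.symm hwo.symm), decide_eq_decide.mpr (key hw1.symm hwb.symm),
    decide_eq_decide.mpr (key hw2.symm hwb.symm), decide_eq_decide.mpr (key hw1.symm hw3.symm),
    decide_eq_decide.mpr (key hw2.symm hw3.symm)⟩

end RootVertexState

section RootVertex

open Classical

variable {V : Type*} {E : Type*} [Fintype E] [DecidableEq E]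
variable {R : Type*} [Field R] [LinearOrder R] [IsStrictOrderedRing R]
variable (ends : E → Sym2 V) (o a₁ a₂ a₃ b : V) (KK : St → St → St → R)

/-- **A root vertex factors out**: `w` unmarked with typed edges exactly `f₁ = w–a₁`, `f₂ = w–a₂`
(any types), every other edge at `w` pinned closed and untyped — the typed count is a nonnegative
multiple of the typed count with `f₁, f₂` removed. -/
theorem typedCount_rootVertex_st
    (hq : ∀ x y w : St, x.q' = true ∨ y.q' = true ∨ w.q' = true → KK x y w = 0)
    {w : V} {f₁ f₂ : E} (h1 : ends f₁ = s(w, a₁)) (h2 : ends f₂ = s(w, a₂)) (h12 : f₁ ≠ f₂)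
    (hwo : w ≠ o) (hw1 : w ≠ a₁) (hw2 : w ≠ a₂) (hw3 : w ≠ a₃) (hwb : w ≠ b)
    (F : Finset E) (h1F : f₁ ∈ F) (h2F : f₂ ∈ F) (z : Config E)
    (hcl : ∀ e, w ∈ ends e → e ≠ f₁ → e ≠ f₂ → e ∉ F ∧ z e = false) (τ : E → ℕ) :
    ∃ c : R, 0 ≤ c ∧ typedCount F z τ (stKer ends o a₁ a₂ a₃ b KK) =
      c * typedCount ((F.erase f₁).erase f₂) (Function.update (Function.update z f₁ false) f₂ false)
        τ (stKer ends o a₁ a₂ a₃ b KK) := by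
  set F₀ := (F.erase f₁).erase f₂ with hF₀
  set z₀ := Function.update (Function.update z f₁ false) f₂ false with hz₀
  set X := typedCount F₀ z₀ τ (stKer ends o a₁ a₂ a₃ b KK) with hX
  -- every placement term is `X` on a live placement and `0` otherwise
  have hterm : ∀ a d c a' d' c' : Bool,
      typedCount F₀ z₀ τ (fun x y w' => stKer ends o a₁ a₂ a₃ b KK
        (Function.update (Function.update x f₂ a') f₁ a)
        (Function.update (Function.update y f₂ d') f₁ d)
        (Function.update (Function.update w' f₂ c') f₁ c)) =
      if ¬ (a = true ∧ a' = true) ∧ ¬ (d = true ∧ d' = true) ∧ ¬ (c = true ∧ c' = true) then X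
        else 0 := by
    intro a d c a' d' c'
    have hz₀1 : z₀ f₁ = false := by rw [hz₀, Function.update_of_ne h12, Function.update_self]
    have hz₀2 : z₀ f₂ = false := by rw [hz₀, Function.update_self]
    have hF₀1 : f₁ ∉ F₀ := fun h => (Finset.mem_erase.1 (Finset.mem_erase.1 h).2).1 rfl
    have hF₀2 : f₂ ∉ F₀ := fun h => (Finset.mem_erase.1 h).1 rfl
    have hclosed : ∀ x : Config E, (∀ e, e ∉ F₀ → x e = z₀ e) →
        x f₁ = false ∧ x f₂ = false ∧ ∀ e, w ∈ ends e → e ≠ f₁ → e ≠ f₂ → x e = false := by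
      intro x hx
      refine ⟨(hx f₁ hF₀1).trans hz₀1, (hx f₂ hF₀2).trans hz₀2, fun e hwe h₁ h₂ => ?_⟩
      have heF : e ∉ F₀ := fun h =>
        (hcl e hwe h₁ h₂).1 (Finset.mem_of_mem_erase (Finset.mem_of_mem_erase h))
      rw [hx e heF, hz₀, Function.update_of_ne h₂, Function.update_of_ne h₁]
      exact (hcl e hwe h₁ h₂).2
    -- a killed copy joins the roots
    have hkill : ∀ (x : Config E) (p p' : Bool), p = true → p' = true →
        (st ends o a₁ a₂ a₃ b (Function.update (Function.update x f₂ p') f₁ p)).q' = true := by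
      intro x p p' hp hp'
      show decide (Conn ends _ a₂ a₁) = true
      refine decide_eq_true (conn_trans (conn_of_openAdj ⟨f₂, ?_, by rw [h2, Sym2.eq_swap]⟩)
        (conn_of_openAdj ⟨f₁, ?_, h1⟩))
      · rw [Function.update_of_ne h12.symm, Function.update_self, hp']
      · rw [Function.update_self, hp]
    by_cases hlive : ¬ (a = true ∧ a' = true) ∧ ¬ (d = true ∧ d' = true) ∧ ¬ (c = true ∧ c' = true)
    · rw [if_pos hlive, hX]
      refine typedCount_congr_K_on _ _ _ fun x y w' hxyw _ => ?_
      obtain ⟨hx1, hx2, hxcl⟩ := hclosed x fun e he => (hxyw e he).1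
      obtain ⟨hy1, hy2, hycl⟩ := hclosed y fun e he => (hxyw e he).2.1
      obtain ⟨hw1', hw2', hwcl⟩ := hclosed w' fun e he => (hxyw e he).2.2
      unfold stKer
      rw [st_rootVertex ends o a₁ a₂ a₃ b h1 h2 h12 hwo hw1 hw2 hw3 hwb hx1 hx2 hxcl hlive.1,
        st_rootVertex ends o a₁ a₂ a₃ b h1 h2 h12 hwo hw1 hw2 hw3 hwb hy1 hy2 hycl hlive.2.1,
        st_rootVertex ends o a₁ a₂ a₃ b h1 h2 h12 hwo hw1 hw2 hw3 hwb hw1' hw2' hwcl hlive.2.2]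
    · rw [if_neg hlive]
      have hsome : (a = true ∧ a' = true) ∨ (d = true ∧ d' = true) ∨ (c = true ∧ c' = true) := by
        by_contra hno
        exact hlive ⟨fun h => hno (Or.inl h), fun h => hno (Or.inr (Or.inl h)),
          fun h => hno (Or.inr (Or.inr h))⟩
      unfold typedCount
      refine Finset.sum_eq_zero fun x _ => Finset.sum_eq_zero fun y _ =>
        Finset.sum_eq_zero fun w' _ => ?_
      refine ite_eq_right_iff.2 fun _ => ?_
      show KK _ _ _ = 0
      rcases hsome with ⟨hp, hp'⟩ | ⟨hp, hp'⟩ | ⟨hp, hp'⟩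
      · exact hq _ _ _ (Or.inl (hkill x a a' hp hp'))
      · exact hq _ _ _ (Or.inr (Or.inl (hkill y d d' hp hp')))
      · exact hq _ _ _ (Or.inr (Or.inr (hkill w' c c' hp hp')))
  -- the coefficient: the number of live placements
  refine ⟨∑ a : Bool, ∑ d : Bool, ∑ c : Bool, if a.toNat + d.toNat + c.toNat = τ f₁ then
      (∑ a' : Bool, ∑ d' : Bool, ∑ c' : Bool, if a'.toNat + d'.toNat + c'.toNat = τ f₂ then
        (if ¬ (a = true ∧ a' = true) ∧ ¬ (d = true ∧ d' = true) ∧ ¬ (c = true ∧ c' = true) then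
          (1 : R) else 0) else 0) else 0, ?_, ?_⟩
  · refine Finset.sum_nonneg fun a _ => Finset.sum_nonneg fun d _ => Finset.sum_nonneg fun c _ => ?_
    split_ifs with hA
    · refine Finset.sum_nonneg fun a' _ => Finset.sum_nonneg fun d' _ =>
        Finset.sum_nonneg fun c' _ => ?_
      split_ifs <;> norm_num
    · exact le_rfl
  · rw [typedCount_split2 F h1F h2F h12, ← hF₀, ← hz₀]
    simp only [hterm, Finset.sum_mul, ite_mul, zero_mul, one_mul]

/-- **A root vertex factors out of the `K₃` count.** -/
theorem typedCount_rootVertex {w : V} {f₁ f₂ : E} (h1 : ends f₁ = s(w, a₁))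
    (h2 : ends f₂ = s(w, a₂)) (h12 : f₁ ≠ f₂)
    (hwo : w ≠ o) (hw1 : w ≠ a₁) (hw2 : w ≠ a₂) (hw3 : w ≠ a₃) (hwb : w ≠ b)
    (F : Finset E) (h1F : f₁ ∈ F) (h2F : f₂ ∈ F) (z : Config E)
    (hcl : ∀ e, w ∈ ends e → e ≠ f₁ → e ≠ f₂ → e ∉ F ∧ z e = false) (τ : E → ℕ) :
    ∃ c : R, 0 ≤ c ∧
      typedCount F z τ (K3 ends o a₁ a₂ a₃ b : Config E → Config E → Config E → R) =
        c * typedCount ((F.erase f₁).erase f₂)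
          (Function.update (Function.update z f₁ false) f₂ false) τ (K3 ends o a₁ a₂ a₃ b) := by
  simp only [K3_eq_stKer]
  exact typedCount_rootVertex_st ends o a₁ a₂ a₃ b _ (ruleKernel_KB (R := R)).root_pair h1 h2 h12
    hwo hw1 hw2 hw3 hwb F h1F h2F z hcl τ

end RootVertex

end TypedRed

end CovForm

end Summit.Ventures.PercRepro2
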